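import Literature.Combinatorics.SetFamily.BiasedMeasure
import Mathlib.Data.Finset.SymmDiff

/-!
# Route NegLimited — flip couplings for the `p`-biased measure, `p ≤ 1/2` (rung F-N1/p3, ROUND-7 input to R7-B)

A supplement to `Literature/Combinatorics/SetFamily/BiasedMeasure.lean` (the `p`-biased product measure `μ_p` on the subsets of a
finite set, as finite sums of `biasedWeight p W`). For `p ≤ 1/2` a coordinate is at least as
likely to be absent as present, so FLIPPING coordinates can only help an up-closed event; the
point of this file is that this remains true when the set of flipped coordinates is chosen as a
function of other, unflipped ("revealed") coordinates:

* `biasedWeight_insert_le` — `μ_p(W ∪ {x}) ≤ μ_p(W)` for `x ∉ W`, `0 ≤ p ≤ 1/2`;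
* `sum_univ_eq_sum_filter_notMem_add` — `∑_W f(W) = ∑_{W ∌ x} (f(W) + f(W ∪ {x}))`;
* `sum_biasedWeight_filter_le_flip` — one conditional flip: if `F` is monotone in the
  coordinate `x` and the condition `c` does not depend on `x`, then
  `Pr_p[F] ≤ Pr_p[W ↦ if c W then F(W ∆ {x}) else F(W)]`;
* `sum_biasedWeight_filter_le_symmDiff` — the conditional multi-flip coupling: for disjoint
  `R`, `N`, a flip set `φ(W) ⊆ N` depending only on `W ∩ R`, and an event `E` up-closed in the
  `N`-coordinates, `Pr_p[E(W)] ≤ Pr_p[E(W ∆ φ(W))]`.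

Equivalently: conditionally on the revealed coordinates, the flipped coordinates are independent
with biases `1 - p ≥ p`, and an up-closed event is more likely under a product measure with
larger biases (the heterogeneous form of the monotone coupling
`sum_biasedWeight_mono_of_monotone`); the coordinate-by-coordinate proof given here avoids
product measures with non-constant biases altogether. Consumed by the biased Matching Sunflower
Lemma R7-B (`NegLimitedMatchingSunflowersBiased.lean`), where it replaces the planned
`HeteroDomination` input (cell record: HOME/pnp-ideate-p3/ROUND-7.md §4 row A/B).

## References

Standard material (monotone couplings of product measures), e.g. S. Janson, T. Łuczak,
A. Ruciński, *Random Graphs* (2000), §1.1; G. Grimmett, *Percolation* (1999), §2.1–2.2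
(increasing events, coupling of product measures). [folklore]
-/

set_option linter.dupNamespace false -- `Summit.PneNP.PneNP.…`: summit = sub-problem name (D-0017 single-conjunct layout)

namespace Summit.PneNP.PneNP.Theorems.BiasedFlip

open Finset Literature.Combinatorics.SetFamily

variable {α : Type*} [Fintype α] [DecidableEq α]

/-! ### Flip couplings for the biased measure with `p ≤ 1/2` -/

/-- Adding a point to a set does not increase its `μ_p`-weight when `p ≤ 1/2`
(`μ_p(W ∪ {x}) / μ_p(W) = p/(1-p) ≤ 1`). [folklore] -/
theorem biasedWeight_insert_le {p : ℝ} (hp0 : 0 ≤ p) (hp : p ≤ 1 / 2) {W : Finset α} {x : α}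
    (hx : x ∉ W) : biasedWeight p (insert x W) ≤ biasedWeight p W := by
  unfold biasedWeight
  have hcard : #(insert x W) = #W + 1 := card_insert_of_notMem hx
  have hle : #W + 1 ≤ Fintype.card α := by
    rw [← hcard]; exact card_le_univ _
  rw [hcard]
  obtain ⟨d, hd⟩ : ∃ d, Fintype.card α - #W = d + 1 := ⟨Fintype.card α - #W - 1, by omega⟩
  rw [show Fintype.card α - (#W + 1) = d by omega, hd, pow_succ, pow_succ]
  have h1 : p ≤ 1 - p := by linarith
  have hk : 0 ≤ p ^ #W := pow_nonneg hp0 _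
  have hd0 : 0 ≤ (1 - p) ^ d := pow_nonneg (by linarith) _
  calc p ^ #W * p * (1 - p) ^ d = p ^ #W * (1 - p) ^ d * p := by ring
    _ ≤ p ^ #W * (1 - p) ^ d * (1 - p) := mul_le_mul_of_nonneg_left h1 (mul_nonneg hk hd0)
    _ = p ^ #W * ((1 - p) ^ d * (1 - p)) := by ring

/-- Splitting a sum over all subsets according to the membership of a fixed point `x`: the
subsets containing `x` are the sets `W ∪ {x}`, `x ∉ W`. [folklore] -/
theorem sum_univ_eq_sum_filter_notMem_add (x : α) (f : Finset α → ℝ) :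
    ∑ W, f W = ∑ W ∈ univ.filter (fun W => x ∉ W), (f W + f (insert x W)) := by
  rw [sum_add_distrib, ← sum_filter_add_sum_filter_not univ (fun W : Finset α => x ∉ W)]
  congr 1
  refine sum_nbij' (fun W => W.erase x) (fun W => insert x W) ?_ ?_ ?_ ?_ ?_
  · intro W hW
    simp only [mem_filter, mem_univ, true_and] at hW ⊢
    exact notMem_erase x W
  · intro W hW
    simp only [mem_filter, mem_univ, true_and, not_not] at hW ⊢
    exact mem_insert_self x W
  · intro W hW
    simp only [mem_filter, mem_univ, true_and, not_not] at hW
    exact insert_erase hW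
  · intro W hW
    simp only [mem_filter, mem_univ, true_and] at hW
    exact erase_insert hW
  · intro W hW
    simp only [mem_filter, mem_univ, true_and, not_not] at hW
    simp only [insert_erase hW]

omit [Fintype α] in
/-- `W ∆ {x} = W ∪ {x}` for `x ∉ W`. [folklore] -/
theorem symmDiff_singleton_eq_insert {W : Finset α} {x : α} (hx : x ∉ W) :
    symmDiff W {x} = insert x W := by
  ext y
  rw [mem_symmDiff, mem_insert, mem_singleton]
  by_cases hy : y = x
  · subst hy; simp [hx]
  · simp [hy]

omit [Fintype α] in
/-- `(W ∪ {x}) ∆ {x} = W` for `x ∉ W`. [folklore] -/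
theorem symmDiff_insert_singleton {W : Finset α} {x : α} (hx : x ∉ W) :
    symmDiff (insert x W) {x} = W := by
  ext y
  rw [mem_symmDiff, mem_insert, mem_singleton]
  by_cases hy : y = x
  · subst hy; simp [hx]
  · simp [hy]

/-- **One conditional flip.** For `0 ≤ p ≤ 1/2`, an event `F` that is monotone in the coordinate
`x`, and a condition `c` that does not depend on the coordinate `x`, flipping the coordinate `x`
on the sets satisfying `c` does not decrease the `μ_p`-probability:
`Pr_p[F] ≤ Pr_p[W ↦ F(W ∆ {x})  if c W, else F W]` (pair `W ∌ x` with `W ∪ {x}` and use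
`μ_p(W ∪ {x}) ≤ μ_p(W)`). [folklore] -/
theorem sum_biasedWeight_filter_le_flip {p : ℝ} (hp0 : 0 ≤ p) (hp : p ≤ 1 / 2) (x : α)
    (c F : Finset α → Prop) [DecidablePred c] [DecidablePred F]
    (hc : ∀ W, x ∉ W → (c W ↔ c (insert x W)))
    (hF : ∀ W, x ∉ W → F W → F (insert x W)) :
    ∑ W ∈ univ.filter F, biasedWeight p W ≤
      ∑ W ∈ univ.filter (fun W => if c W then F (symmDiff W {x}) else F W), biasedWeight p W := by
  rw [sum_filter, sum_filter, sum_univ_eq_sum_filter_notMem_add x,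
    sum_univ_eq_sum_filter_notMem_add x]
  refine sum_le_sum fun W hW => ?_
  have hx : x ∉ W := (mem_filter.1 hW).2
  have hwt := biasedWeight_insert_le hp0 hp hx
  have hw0 : 0 ≤ biasedWeight p (insert x W) :=
    biasedWeight_nonneg hp0 (by linarith) _
  by_cases hcW : c W
  · have hcW' : c (insert x W) := (hc W hx).1 hcW
    simp only [if_pos hcW, if_pos hcW', symmDiff_singleton_eq_insert hx,
      symmDiff_insert_singleton hx]
    by_cases h1 : F W
    · have h2 := hF W hx h1
      simp [h1, h2]
    · by_cases h2 : F (insert x W)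
      · simp only [h1, h2, if_false, if_true, zero_add, add_zero]; exact hwt
      · simp [h1, h2]
  · have hcW' : ¬ c (insert x W) := fun h => hcW ((hc W hx).2 h)
    simp only [if_neg hcW, if_neg hcW']
    exact le_rfl

omit [Fintype α] in
/-- `(W ∪ {x}) ∆ S = (W ∆ S) ∪ {x}` for `x ∉ S`. [folklore] -/
theorem symmDiff_insert_left_of_notMem {W S : Finset α} {x : α} (hx : x ∉ S) :
    symmDiff (insert x W) S = insert x (symmDiff W S) := by
  ext y
  rw [mem_symmDiff, mem_insert, mem_insert, mem_symmDiff]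
  by_cases hy : y = x
  · subst hy; simp [hx]
  · simp [hy]

omit [Fintype α] in
/-- `(W ∆ {x}) ∆ S = W ∆ (S ∪ {x})` for `x ∉ S`. [folklore] -/
theorem symmDiff_singleton_symmDiff_eq {W S : Finset α} {x : α} (hx : x ∉ S) :
    symmDiff (symmDiff W {x}) S = symmDiff W (insert x S) := by
  rw [symmDiff_assoc]
  congr 1
  ext y
  rw [mem_symmDiff, mem_insert, mem_singleton]
  by_cases hy : y = x
  · subst hy; simp [hx]
  · simp [hy]

/-- **Conditional multi-flip coupling.** Let `0 ≤ p ≤ 1/2`, let `R` ("revealed") and `N` be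
disjoint sets of coordinates, let `φ W ⊆ N` be a set of coordinates to flip that depends only on
`W ∩ R`, and let `E` be an event that is up-closed in the `N`-coordinates. Then
`Pr_{W ∼ μ_p}[E(W)] ≤ Pr_{W ∼ μ_p}[E(W ∆ φ(W))]`: conditionally on `W ∩ R` the flipped
coordinates are independent with biases `1 - p ≥ p`, under which an up-closed event is at least
as likely (proved by flipping one coordinate at a time, `sum_biasedWeight_filter_le_flip`).
[folklore] -/
theorem sum_biasedWeight_filter_le_symmDiff {p : ℝ} (hp0 : 0 ≤ p) (hp : p ≤ 1 / 2)
    (R N : Finset α) (hRN : Disjoint R N) (φ : Finset α → Finset α)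
    (hφN : ∀ W, φ W ⊆ N) (hφR : ∀ W, φ W = φ (W ∩ R))
    (E : Finset α → Prop) [DecidablePred E] (hE : ∀ x ∈ N, ∀ W, E W → E (insert x W)) :
    ∑ W ∈ univ.filter E, biasedWeight p W ≤
      ∑ W ∈ univ.filter (fun W => E (symmDiff W (φ W))), biasedWeight p W := by
  classical
  induction N using Finset.induction_on generalizing φ E with
  | empty =>
    have h0 : ∀ W, φ W = ∅ := fun W => subset_empty.1 (hφN W)
    refine le_of_eq (sum_congr ?_ fun _ _ => rfl)
    ext W
    simp only [mem_filter, mem_univ, true_and, h0 W]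
    rw [show symmDiff W (∅ : Finset α) = W from symmDiff_bot W]
  | insert x N' hxN' ih =>
    have hxR : x ∉ R := fun h => disjoint_left.1 hRN h (mem_insert_self x N')
    have hRN' : Disjoint R N' := Disjoint.mono_right (subset_insert x N') hRN
    -- first flip the coordinates of `N'`
    set φ' : Finset α → Finset α := fun W => (φ W).erase x with hφ'
    have hφ'N' : ∀ W, φ' W ⊆ N' := fun W y hy => by
      have hy' := mem_erase.1 hy
      have := hφN W hy'.2
      rcases mem_insert.1 this with h | h
      · exact absurd h hy'.1
      · exact h
    have hφ'R : ∀ W, φ' W = φ' (W ∩ R) := fun W => by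
      simp only [hφ']; rw [← hφR W]
    have hxφ' : ∀ W, x ∉ φ' W := fun W => notMem_erase x _
    have hE' : ∀ y ∈ N', ∀ W, E W → E (insert y W) := fun y hy => hE y (mem_insert_of_mem hy)
    have step1 := ih hRN' φ' hφ'N' hφ'R E hE'
    -- then flip `x` where `x ∈ φ W`
    set F : Finset α → Prop := fun W => E (symmDiff W (φ' W)) with hFdef
    have hφ'ins : ∀ W, φ' (insert x W) = φ' W := fun W => by
      rw [hφ'R, insert_inter_of_notMem hxR, ← hφ'R]
    have hφins : ∀ W, φ (insert x W) = φ W := fun W => by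
      rw [hφR, insert_inter_of_notMem hxR, ← hφR]
    have hc : ∀ W, x ∉ W → (x ∈ φ W ↔ x ∈ φ (insert x W)) := fun W _ => by rw [hφins]
    have hF : ∀ W, x ∉ W → F W → F (insert x W) := fun W _ hFW => by
      simp only [hFdef] at hFW ⊢
      rw [hφ'ins, symmDiff_insert_left_of_notMem (hxφ' W)]
      exact hE x (mem_insert_self x N') _ hFW
    have step2 := sum_biasedWeight_filter_le_flip hp0 hp x (fun W => x ∈ φ W) F hc hF
    refine step1.trans (step2.trans (le_of_eq (sum_congr ?_ fun _ _ => rfl)))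
    ext W
    simp only [mem_filter, mem_univ, true_and, hFdef]
    by_cases hxW : x ∈ φ W
    · rw [if_pos hxW]
      have h1 : φ' (symmDiff W {x}) = φ' W := by
        rw [hφ'R (symmDiff W {x}), hφ'R W]
        congr 1
        ext y
        rw [mem_inter, mem_inter, mem_symmDiff, mem_singleton]
        by_cases hy : y = x
        · subst hy; simp [hxR]
        · simp [hy]
      rw [h1, symmDiff_singleton_symmDiff_eq (hxφ' W)]
      simp only [hφ', insert_erase hxW]
    · rw [if_neg hxW]
      simp only [hφ', erase_eq_of_notMem hxW]

end Summit.PneNP.PneNP.Theorems.BiasedFlip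


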